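import Summits.BirchSwinnertonDyer.BirchSwinnertonDyer.Theorems.EisensteinDepletionAtTwoStarDoorThreePrints
import HarnessLib

/-!
# Route `EisensteinDepletionAtTwo`, aside crux `StarOptB` (item stmt-BirchSwinnertonDyer-24445), registered line `regimes`
# (planner bsd-rank2-p2 GEN 25, skeleton sha16 456c49be9d59bace): its two open stubs FOLLOW FROM THE CRUX, hence from the two prints (F) + UBD

The registered skeleton `regimes` splits `StarOptB` (the `X₀(N)`-optimal curve `W₀` of a habitat class carries a rational `2`-torsion abscissa
that is odd and not ramified at `2`) by the regime of `W₀`: `stub_uniqueRegime` (if `W₀` has EXACTLY ONE rational `2`-torsion abscissa `x₀`, then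
`x₀` is odd and étale) and `stub_hubRegime` (if `W₀` has two distinct rational `2`-torsion abscissae, SOME rational one is odd and étale); the third
stub `stub_twoTorsionOfIsogenous` is landed (`Theorems/EisensteinDepletionAtTwoStarOptBTwoTorsionOfIsogenous`).  This file records, kernel-checked,
that the split is a PARTITION, not a reduction: each of the two open stubs is implied by `StarOptB` itself (verbatim signatures of the registered
stubs as conclusions) —

* `stub_uniqueRegime_of_starOptB : StarOptB → stub_uniqueRegime` (the crux's witness `x'` equals `x₀` by uniqueness);
* `stub_hubRegime_of_starOptB : StarOptB → stub_hubRegime` (the crux's witness is the wanted one; the two given abscissae are not used);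

so that, with the skeleton's own composition `StarOptB_of`, the open stubs of `regimes` are jointly EQUIVALENT to the crux, and each holds exactly
where the crux does: modulo the two named prints (F) `gamma1Parametrization_cuspImage_nonsingularReduction` and UBD
`CalegariDimitrovTang2025_unboundedDenominators`, through the tree door `SigmaNode.starOptB_of_twoPrints` (line `star` v16) —
`stub_uniqueRegime_of_twoPrints`, `stub_hubRegime_of_twoPrints`.

HONEST FRAMING: the two `_of_starOptB` theorems are unconditional but close nothing (converse direction); the two `_of_twoPrints` theorems are
CONDITIONAL on (F) and UBD; no registered stub of `regimes` is closed by name; item 24445, the leaf T-r3₂ and BSD are NOT proved; nothing here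
reads an analytic rank (PARTITION D-0054: none — axis S0, no S0 motion).  No `sorry`, no definition.
-/

set_option linter.dupNamespace false
set_option autoImplicit false

noncomputable section

open WeierstrassCurve Literature.NumberTheory.EllipticCurves Literature.NumberTheory.EllipticCurves.Greenberg1999
open Literature.NumberTheory.EllipticCurves.ModularForms

namespace Summit.BirchSwinnertonDyer.BirchSwinnertonDyer.Theorems.DepletionAtTwo.Regimes

/-- **Registered stub `stub_uniqueRegime` of line `regimes` FROM the crux `StarOptB`** (verbatim the registered signature as conclusion): the crux
supplies a rational `2`-torsion abscissa of `W₀` that is odd and not ramified at `2`; by the uniqueness clause of `HasUniqueRationalTwoTorsionX W₀ x₀`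
it is `x₀`.  Unconditional; closes nothing (converse direction of the skeleton's `StarOptB_of`). [cite: Stevens1989, §2] -/
theorem stub_uniqueRegime_of_starOptB
    (h : Summit.BirchSwinnertonDyer.BirchSwinnertonDyer.Theses.EisensteinDepletionAtTwo.StarOptB) :
    ∀ (W : WeierstrassCurve ℚ) [W.IsElliptic] [W.IsGloballyMinimal] (x : ℚ),
      IsOrdinaryAt W 2 → HasUniqueRationalTwoTorsionX W x →
      ((TwoTorsionRamifiedAtTwo x ∧ ¬ TwoTorsionOdd W x) ∨
        (TwoTorsionOdd W x ∧ ¬ TwoTorsionRamifiedAtTwo x)) →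
      W.conductorNorm ℤ ≠ 15 →
      ∀ ⦃N : ℕ⦄ [NeZero N] (f : CuspForm (CongruenceSubgroup.Gamma0 N) 2), IsNewformOf W f →
      ∀ (W₀ : WeierstrassCurve ℚ) [W₀.IsElliptic] [W₀.IsGloballyMinimal], IsNewformOf W₀ f →
      ∀ (L₀ : PeriodPair), IsNeronLatticeOf (W₀.baseChange ℂ) L₀ →
      ∀ (q : ℚ), q ≠ 0 → (∀ z ∈ periodLattice f, (q : ℂ) * z ∈ L₀.lattice) →
      (∀ z ∈ L₀.lattice, ∃ w ∈ periodLattice f, z = (q : ℂ) * w) →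
      ∀ (x₀ : ℚ), HasUniqueRationalTwoTorsionX W₀ x₀ →
        TwoTorsionOdd W₀ x₀ ∧ ¬ TwoTorsionRamifiedAtTwo x₀ := by
  intro W _ _ x hord hux htype h15 N _ f hW W₀ _ _ hW₀ L₀ hL₀ q hq hin hout x₀ hx₀
  obtain ⟨x', hx', hodd, hnram⟩ := h W x hord hux htype h15 f hW W₀ hW₀ L₀ hL₀ q hq hin hout
  obtain rfl : x' = x₀ := hx₀.2 x' hx'
  exact ⟨hodd, hnram⟩

/-- **Registered stub `stub_hubRegime` of line `regimes` FROM the crux `StarOptB`** (verbatim the registered signature as conclusion): the crux's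
witness is the wanted odd étale rational abscissa; the two given abscissae `x₀ ≠ x₁` are not needed.  Unconditional; closes nothing.
[cite: Stevens1989, §2] -/
theorem stub_hubRegime_of_starOptB
    (h : Summit.BirchSwinnertonDyer.BirchSwinnertonDyer.Theses.EisensteinDepletionAtTwo.StarOptB) :
    ∀ (W : WeierstrassCurve ℚ) [W.IsElliptic] [W.IsGloballyMinimal] (x : ℚ),
      IsOrdinaryAt W 2 → HasUniqueRationalTwoTorsionX W x →
      ((TwoTorsionRamifiedAtTwo x ∧ ¬ TwoTorsionOdd W x) ∨
        (TwoTorsionOdd W x ∧ ¬ TwoTorsionRamifiedAtTwo x)) →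
      W.conductorNorm ℤ ≠ 15 →
      ∀ ⦃N : ℕ⦄ [NeZero N] (f : CuspForm (CongruenceSubgroup.Gamma0 N) 2), IsNewformOf W f →
      ∀ (W₀ : WeierstrassCurve ℚ) [W₀.IsElliptic] [W₀.IsGloballyMinimal], IsNewformOf W₀ f →
      ∀ (L₀ : PeriodPair), IsNeronLatticeOf (W₀.baseChange ℂ) L₀ →
      ∀ (q : ℚ), q ≠ 0 → (∀ z ∈ periodLattice f, (q : ℂ) * z ∈ L₀.lattice) →
      (∀ z ∈ L₀.lattice, ∃ w ∈ periodLattice f, z = (q : ℂ) * w) →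
      ∀ (x₀ x₁ : ℚ), x₀ ≠ x₁ → HasRationalTwoTorsionX W₀ x₀ → HasRationalTwoTorsionX W₀ x₁ →
        ∃ x' : ℚ, HasRationalTwoTorsionX W₀ x' ∧ TwoTorsionOdd W₀ x' ∧ ¬ TwoTorsionRamifiedAtTwo x' := by
  intro W _ _ x hord hux htype h15 N _ f hW W₀ _ _ hW₀ L₀ hL₀ q hq hin hout _ _ _ _ _
  exact h W x hord hux htype h15 f hW W₀ hW₀ L₀ hL₀ q hq hin hout

/-- **`stub_uniqueRegime` modulo the two prints (F) + UBD** — `stub_uniqueRegime_of_starOptB` on the tree door `SigmaNode.starOptB_of_twoPrints`.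
CONDITIONAL RESULT (two named facts); the registered stub is NOT closed by this.
[cite: ConradEdixhovenStein2003, §6.1.2 proof of Lemma 6.1.6 (p. 381)] [cite: CalegariDimitrovTang2025, Thm. 1.0.1] -/
theorem stub_uniqueRegime_of_twoPrints (hF : gamma1Parametrization_cuspImage_nonsingularReduction)
    (hU : Literature.NumberTheory.Automorphic.CalegariDimitrovTang2025_unboundedDenominators) :
    ∀ (W : WeierstrassCurve ℚ) [W.IsElliptic] [W.IsGloballyMinimal] (x : ℚ),
      IsOrdinaryAt W 2 → HasUniqueRationalTwoTorsionX W x →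
      ((TwoTorsionRamifiedAtTwo x ∧ ¬ TwoTorsionOdd W x) ∨
        (TwoTorsionOdd W x ∧ ¬ TwoTorsionRamifiedAtTwo x)) →
      W.conductorNorm ℤ ≠ 15 →
      ∀ ⦃N : ℕ⦄ [NeZero N] (f : CuspForm (CongruenceSubgroup.Gamma0 N) 2), IsNewformOf W f →
      ∀ (W₀ : WeierstrassCurve ℚ) [W₀.IsElliptic] [W₀.IsGloballyMinimal], IsNewformOf W₀ f →
      ∀ (L₀ : PeriodPair), IsNeronLatticeOf (W₀.baseChange ℂ) L₀ →
      ∀ (q : ℚ), q ≠ 0 → (∀ z ∈ periodLattice f, (q : ℂ) * z ∈ L₀.lattice) →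
      (∀ z ∈ L₀.lattice, ∃ w ∈ periodLattice f, z = (q : ℂ) * w) →
      ∀ (x₀ : ℚ), HasUniqueRationalTwoTorsionX W₀ x₀ →
        TwoTorsionOdd W₀ x₀ ∧ ¬ TwoTorsionRamifiedAtTwo x₀ :=
  stub_uniqueRegime_of_starOptB (SigmaNode.starOptB_of_twoPrints hF hU)

/-- **`stub_hubRegime` modulo the two prints (F) + UBD** — `stub_hubRegime_of_starOptB` on `SigmaNode.starOptB_of_twoPrints`.
CONDITIONAL RESULT (two named facts); the registered stub is NOT closed by this.
[cite: ConradEdixhovenStein2003, §6.1.2 proof of Lemma 6.1.6 (p. 381)] [cite: CalegariDimitrovTang2025, Thm. 1.0.1] -/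
theorem stub_hubRegime_of_twoPrints (hF : gamma1Parametrization_cuspImage_nonsingularReduction)
    (hU : Literature.NumberTheory.Automorphic.CalegariDimitrovTang2025_unboundedDenominators) :
    ∀ (W : WeierstrassCurve ℚ) [W.IsElliptic] [W.IsGloballyMinimal] (x : ℚ),
      IsOrdinaryAt W 2 → HasUniqueRationalTwoTorsionX W x →
      ((TwoTorsionRamifiedAtTwo x ∧ ¬ TwoTorsionOdd W x) ∨
        (TwoTorsionOdd W x ∧ ¬ TwoTorsionRamifiedAtTwo x)) →
      W.conductorNorm ℤ ≠ 15 →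
      ∀ ⦃N : ℕ⦄ [NeZero N] (f : CuspForm (CongruenceSubgroup.Gamma0 N) 2), IsNewformOf W f →
      ∀ (W₀ : WeierstrassCurve ℚ) [W₀.IsElliptic] [W₀.IsGloballyMinimal], IsNewformOf W₀ f →
      ∀ (L₀ : PeriodPair), IsNeronLatticeOf (W₀.baseChange ℂ) L₀ →
      ∀ (q : ℚ), q ≠ 0 → (∀ z ∈ periodLattice f, (q : ℂ) * z ∈ L₀.lattice) →
      (∀ z ∈ L₀.lattice, ∃ w ∈ periodLattice f, z = (q : ℂ) * w) →
      ∀ (x₀ x₁ : ℚ), x₀ ≠ x₁ → HasRationalTwoTorsionX W₀ x₀ → HasRationalTwoTorsionX W₀ x₁ →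
        ∃ x' : ℚ, HasRationalTwoTorsionX W₀ x' ∧ TwoTorsionOdd W₀ x' ∧ ¬ TwoTorsionRamifiedAtTwo x' :=
  stub_hubRegime_of_starOptB (SigmaNode.starOptB_of_twoPrints hF hU)

end Summit.BirchSwinnertonDyer.BirchSwinnertonDyer.Theorems.DepletionAtTwo.Regimes

end
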